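import Mathlib
import HarnessLib
import Summits.ResolutionOfSingularities.ResolutionOfSingularities.Theorems.WildQuotientsWildQuotientResolutionS1aModelNodeAtlas

/-!
# S1a — MULTI-SUPPORT ROOTS (α1, step 2): the MOVE ATLAS from a FINITE FAMILY OF CHART DATA with exposed producer nodes

[OURS · L1 W4.5c · lead-1 g16; plan-1 RULING R-F15o (3) design (α1) «`exists_moveAtlas_of_nodes` for a FINITE family of chart data (Wᵢ ⊇ supp 𝒦ᵢ) …; the F-locus
clause is per Wᵢ, the atlas is the union»; = the per-datum chart construction of ✓`exists_moveAtlas_of_node` (`…S1aModelNodeAtlas`, p661308 lineage) followed by ONE call of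
✓`exists_moveAtlas_of_nodeData` (`…S1aMoveResidual`) with `O = ⋃ᵢ Wᵢ` and the chart family indexed by `Σ i, Fin L`] — NOT statements of the manuscript; counted 0;
AI-level work, weaker than expert review. Crux stmt-ResolutionOfSingularities-17941 `CyclicQuotientFourfolds`, line `s1a-logminvertex` v13 (`stub_reachLowerInFX`).

* ★★ `exists_moveAtlas_of_nodes` — `M` a model with an atlas `𝔄`; finitely many stable affine charts `Wᵢ` with explicit nodes `(Bᵢ, 𝒜ᵢ, σᵢ, eᵢ)` and K1′-regular σ-adapted
  homogeneous weighted centres `(fᵢ, wᵢ)`; ONE `G`-stable centre `𝒦` of Veronese degree `d` with `(𝒦|Wᵢ)_n = eᵢ⁻¹(trace 𝒥ₙ(fᵢ,wᵢ))` for every `i` and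
  `supp 𝒦_d ⊆ ⋃ Wᵢ` (e.g. the glued centre of ✓`MultiRoot.isAdmissibleCentre_infRees_of_disjoint` with `Wᵢ` missing the other supports); a realisation `π′ : M′ → M`;
  per chart `i`: a σ-fixed cover `y_{i,j} ∈ K_{dk}` with the radical condition, (H1) on `R^{wᵢ}`, and degree-0 RESIDUAL elements `z_{i,j,l}`. CONCLUSION: stable affine
  producer charts `O′_{i,j} = M′[Wᵢ, eᵢ⁻¹y_{i,j}]`, exposed pinned tame intertwining node isomorphisms `E_{i,j}`, and an atlas `𝔄′` on `M′` with
  `F_𝔄′ ⊆ π′⁻¹(F_𝔄 ∖ ⋃ Wᵢ) ∪ ⋃_{i,j} (O′_{i,j} ∩ V(E_{i,j}⁻¹ z_{i,j,·}))`.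
-/

set_option linter.dupNamespace false

noncomputable section

open CategoryTheory Limits AlgebraicGeometry TopologicalSpace Topology Opposite
open Literature.AlgebraicGeometry.Resolution Literature.AlgebraicGeometry.RelativeSpec
open Summit.ResolutionOfSingularities.ResolutionOfSingularities.Theorems.WildQuotientResolution.S1
open Summit.ResolutionOfSingularities.ResolutionOfSingularities.Theorems.WildQuotientResolution.S1.NodeAtlas
open Summit.ResolutionOfSingularities.ResolutionOfSingularities.Theorems.WildQuotientResolution.S1.CoarseChart
open Summit.ResolutionOfSingularities.ResolutionOfSingularities.Theorems.WildQuotientResolution.S1.ProducerStep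
open Summit.ResolutionOfSingularities.ResolutionOfSingularities.Theorems.WildQuotientResolution.S1.NpFrame
open Summit.ResolutionOfSingularities.ResolutionOfSingularities.Theorems.WildQuotientResolution.S1.GoodCharts
open Summit.ResolutionOfSingularities.ResolutionOfSingularities.Theorems.WildQuotientResolution.S1.BlowupCharts
open Summit.ResolutionOfSingularities.ResolutionOfSingularities.Theorems.WildQuotientResolution.S1.KillableTransport
open Summit.ResolutionOfSingularities.ResolutionOfSingularities.Theorems.WildQuotientResolution.S1.KillCert
open Summit.ResolutionOfSingularities.ResolutionOfSingularities.Theorems.WildQuotientResolution.BlowupExit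

namespace Summit.ResolutionOfSingularities.ResolutionOfSingularities.Theorems.WildQuotientResolution.S1.GameFrame.GModel

variable {p : ℕ} {X' X₁ : Scheme.{0}} {q : X' ⟶ X₁} {G : Type} [Group G] {ρ : G →* Aut X'} {g₀ : G}

set_option maxHeartbeats 3200000 in
/-- ★★ **THE MOVE ATLAS ON A REALISATION FROM A FINITE FAMILY OF CHART DATA, WITH EXPOSED PRODUCER NODES.** See the module docstring.
[OURS · L1 W4.5c · (α1) multi-support X-scheme MOVE (atlas half); NOT a statement of the manuscript] -/
theorem exists_moveAtlas_of_nodes [Finite G] (hp : 0 < p) (hG : ∀ g : G, g ∈ Subgroup.zpowers g₀) (M M' : GModel p q G ρ g₀)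
    (𝔄 : NodeAtlasData p M.act g₀) {η : Type} [Finite η] (W : η → M.act.StableAffineOpens) (hW : ∀ i, IsAffineOpen (W i).1)
    {m : ℕ} (r : Fin m → ℕ) {B : η → Type} [∀ i, CommRing (B i)] (𝒜 : ∀ i, (Π j : Fin m, ZMod (r j)) → AddSubgroup (B i)) [∀ i, GradedRing (𝒜 i)] {c : ℕ}
    (f : ∀ i, Fin c → B i) {δ : ∀ _ : η, Fin c → Π j : Fin m, ZMod (r j)} (w : η → Fin c → ℕ) (hf : ∀ i l, f i l ∈ 𝒜 i (δ i l))
    (σ : ∀ i, B i ≃+* B i) (e : ∀ i, Γ(M.V, (W i).1) ≃+* ↥(𝒜 i 0)) (htame : ∀ i, IsTameNode p (B i) (𝒜 i) (σ i)) (hσp : ∀ i (x : B i), (⇑(σ i))^[p] x = x)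
    (hσ : ∀ i (t : Γ(M.V, (W i).1)), ((e i ((M.act.aut g₀⁻¹).hom.appLE (W i).1 (W i).1 ((W i).2.1 g₀⁻¹).ge t) : ↥(𝒜 i 0)) : B i) = σ i ((e i t : ↥(𝒜 i 0)) : B i))
    (hw : ∀ i l, 0 < w i l) (hK1 : ∀ i, RingTheory.Sequence.IsRegular (B i) (List.ofFn (f i))) (hK1' : ∀ i, IsRegularRing (B i ⧸ Ideal.span (Set.range (f i))))
    (hσJ : ∀ i (n : ℕ), ((weightedFiltration (f i) (w i)).ideal n).map (σ i : B i →+* B i) ≤ (weightedFiltration (f i) (w i)).ideal n)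
    (𝒦 : ReesFiltration M.V) (d : ℕ) (h𝒦G : ∀ (g : G) (n : ℕ), (𝒦.ideal n).comap (M.act.aut g).hom = 𝒦.ideal n)
    (h𝒦O : ∀ i n, (𝒦.filtration ⟨(W i).1, hW i⟩).ideal n = ((traceFiltration (𝒜 i) (f i) (w i)).ideal n).comap (e i : Γ(M.V, (W i).1) →+* ↥(𝒜 i 0)))
    (hver : ∀ i, VeroneseNormalised (𝒜 i) (f i) (w i) d) (hsuppW : (((𝒦.ideal d).support : Set M.V)) ⊆ ⋃ i, ((W i).1 : Set M.V))
    (π' : M'.V ⟶ M.V) (hbl : IsBlowup π' (𝒦.ideal d)) (hr : M'.r = π' ≫ M.r)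
    (hcomm : ∀ g : G, (M'.act.aut g).hom ≫ π' = π' ≫ (M.act.aut g).hom)
    {k : ℕ} (hk : 0 < k) {L : ℕ} (y : ∀ i, Fin L → ↥(𝒜 i 0)) (hy : ∀ i j, y i j ∈ (traceFiltration (𝒜 i) (f i) (w i)).ideal (d * k)) (hσy : ∀ i j, σ i (y i j : B i) = y i j)
    (hrad : ∀ i (l : Fin c), cobordantAlgebra.u' (f i) (w i) l ∈ (Ideal.span (Set.range fun j => coverElement (𝒜 i) (f i) (w i) (d * k) (y i j) (hy i j))).radical)
    (g : ∀ i, ↥(cobordantAlgebra (f i) (w i))) (h1 : ∀ i, augmentationIdeal (sigmaR (σ i) (f i) (w i) (hσJ i) hp (hσp i)) ≤ Ideal.span {g i})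
    (n : η → Fin L → ℕ) (z : ∀ i j, Fin (n i j) → ChartRing (𝒜 i) (f i) (w i) (d * k) (y i j) (hy i j))
    (hz0 : ∀ i j l, z i j l ∈ chartNodeGrading r (𝒜 i) (f i) (w i) (hf i) (d * k) (y i j) (hy i j) 0)
    (hzres : ∀ i j l, z i j l ∈ ((augmentationIdeal (sigmaR (σ i) (f i) (w i) (hσJ i) hp (hσp i))).colon (Ideal.span {g i})).map
      (algebraMap _ (ChartRing (𝒜 i) (f i) (w i) (d * k) (y i j) (hy i j)))) :
    ∃ (O' : η → Fin L → M'.act.StableAffineOpens) (_ : ∀ i j, IsAffineOpen (O' i j).1)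
      (_ : ∀ i j, (O' i j).1 = blowupChart π' ((𝒦.ideal d) ^ k) ⟨(W i).1, hW i⟩ ((e i).symm (y i j)))
      (E : ∀ i j, letI := chartNodeGradedRing r (𝒜 i) (f i) (w i) (hf i) (d * k) (y i j) (hy i j);
        Γ(M'.V, (O' i j).1) ≃+* ↥(chartNodeGrading r (𝒜 i) (f i) (w i) (hf i) (d * k) (y i j) (hy i j) 0)),
      (∀ i j, letI := chartNodeGradedRing r (𝒜 i) (f i) (w i) (hf i) (d * k) (y i j) (hy i j);
        IsTameNode p (ChartRing (𝒜 i) (f i) (w i) (d * k) (y i j) (hy i j)) (chartNodeGrading r (𝒜 i) (f i) (w i) (hf i) (d * k) (y i j) (hy i j))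
          (sigmaChart (𝒜 i) (f i) (w i) (d * k) (y i j) (hy i j) (σ i) (hσJ i) hp (hσp i) (hσy i j))) ∧
      (∀ i j, letI := chartNodeGradedRing r (𝒜 i) (f i) (w i) (hf i) (d * k) (y i j) (hy i j); ∀ t' : Γ(M'.V, (O' i j).1),
        ((E i j ((M'.act.aut g₀⁻¹).hom.appLE (O' i j).1 (O' i j).1 ((O' i j).2.1 g₀⁻¹).ge t') :
            ↥(chartNodeGrading r (𝒜 i) (f i) (w i) (hf i) (d * k) (y i j) (hy i j) 0)) : ChartRing (𝒜 i) (f i) (w i) (d * k) (y i j) (hy i j)) =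
          sigmaChart (𝒜 i) (f i) (w i) (d * k) (y i j) (hy i j) (σ i) (hσJ i) hp (hσp i) (hσy i j)
            ((E i j t' : ↥(chartNodeGrading r (𝒜 i) (f i) (w i) (hf i) (d * k) (y i j) (hy i j) 0)) : ChartRing (𝒜 i) (f i) (w i) (d * k) (y i j) (hy i j))) ∧
      (∀ i j (hle : (O' i j).1 ≤ π' ⁻¹ᵁ (W i).1) (x : Γ(M.V, (W i).1)), letI := chartNodeGradedRing r (𝒜 i) (f i) (w i) (hf i) (d * k) (y i j) (hy i j);
        ((E i j (π'.appLE (W i).1 (O' i j).1 hle x) : ↥(chartNodeGrading r (𝒜 i) (f i) (w i) (hf i) (d * k) (y i j) (hy i j) 0)) :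
            ChartRing (𝒜 i) (f i) (w i) (d * k) (y i j) (hy i j)) = toChartRing (𝒜 i) (f i) (w i) (d * k) (y i j) (hy i j) (e i x)) ∧
      ∃ 𝔄' : NodeAtlasData p M'.act g₀,
        𝔄'.fLocus ⊆ π'.base ⁻¹' (𝔄.fLocus \ ⋃ i, ((W i).1 : Set M.V)) ∪
          ⋃ i, ⋃ j, ((O' i j).1 : Set M'.V) ∩ {v | ∀ l, letI := chartNodeGradedRing r (𝒜 i) (f i) (w i) (hf i) (d * k) (y i j) (hy i j);
            v ∉ M'.V.basicOpen ((E i j).symm ⟨z i j l, hz0 i j l⟩)} := by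
  classical
  have hk0 : k ≠ 0 := hk.ne'
  have hverbar : ∀ i, VeroneseNormalised (𝒜 i) (f i) (w i) (d * k) := fun i => CoarseChart.veroneseNormalised_mul (𝒜 i) _ _ (hver i) hk
  have hπ' : IsBlowup π' ((𝒦.ideal d) ^ k) := isBlowup_pow hbl hk0
  have hJ' : ∀ i, ((𝒦.ideal d) ^ k).ideal ⟨(W i).1, hW i⟩ = ((traceFiltration (𝒜 i) (f i) (w i)).ideal (d * k)).comap (e i : Γ(M.V, (W i).1) →+* ↥(𝒜 i 0)) := fun i => by
    rw [Scheme.IdealSheafData.ideal_pow, Pi.pow_apply, ← ReesFiltration.filtration_ideal, h𝒦O i d, (hver i).2 k, comap_equiv_pow]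
  -- the producer charts
  have hxJ : ∀ i j, (e i).symm (y i j) ∈ ((𝒦.ideal d) ^ k).ideal ⟨(W i).1, hW i⟩ := fun i j => by
    rw [hJ' i, Ideal.mem_comap, RingHom.coe_coe, (e i).apply_symm_apply]; exact hy i j
  have hfix : ∀ i j (g : G), (M.act.aut g).hom.appLE (W i).1 (W i).1 ((W i).2.1 g).ge ((e i).symm (y i j)) = (e i).symm (y i j) := fun i j g => by
    have hfix₀ : (M.act.aut g₀⁻¹).hom.appLE (W i).1 (W i).1 ((W i).2.1 g₀⁻¹).ge ((e i).symm (y i j)) = (e i).symm (y i j) := by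
      apply (e i).injective
      apply Subtype.ext
      rw [hσ i ((e i).symm (y i j)), (e i).apply_symm_apply]
      exact hσy i j
    exact appLE_aut_eq_self_of_mem_zpowers M.act (W i).1 (W i).2.1 hfix₀ (by rw [Subgroup.zpowers_inv]; exact hG g)
  have hρk : ∀ g : G, ((𝒦.ideal d) ^ k).comap (M.act.aut g).hom = (𝒦.ideal d) ^ k := fun g => by
    rw [comap_pow]; exact congrArg (· ^ k) (h𝒦G g d)
  have hWex : ∀ i j, ∃ O' : M'.act.StableAffineOpens, O'.1 = blowupChart π' ((𝒦.ideal d) ^ k) ⟨(W i).1, hW i⟩ ((e i).symm (y i j)) ∧ IsAffineOpen O'.1 := fun i j =>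
    exists_stable_blowupChart M.act hπ' M'.act hr hcomm hρk (W i) (hW i) ((e i).symm (y i j)) (hxJ i j) (hfix i j)
  choose OW hOWeq hOWaff using hWex
  have hnode := fun i j => exists_nodeData_blowupChart_pin M.act M'.act hcomm g₀ r (𝒜 i) (f i) (w i) (hf i) hp (W i) (hW i) (σ i) (e i) (htame i) (hσp i) (hσ i)
    (hw i) (hK1 i) (hK1' i) (hσJ i) hπ' (hverbar i) (hJ' i) (y i j) (hy i j) (hσy i j) (OW i j) (hOWeq i j)
  choose E htame' hE hpin using hnode
  -- the literal nodes and their residual sets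
  obtain ⟨DW, hDWdef⟩ : ∃ DW : ∀ i j, NodeData p M'.act g₀ (OW i j), DW = fun i j =>
      letI := chartNodeGradedRing r (𝒜 i) (f i) (w i) (hf i) (d * k) (y i j) (hy i j)
      { affine := hOWaff i j, m := m + 1, r := Fin.cons 0 r, B := ChartRing (𝒜 i) (f i) (w i) (d * k) (y i j) (hy i j),
        𝒜 := chartNodeGrading r (𝒜 i) (f i) (w i) (hf i) (d * k) (y i j) (hy i j),
        σ := sigmaChart (𝒜 i) (f i) (w i) (d * k) (y i j) (hy i j) (σ i) (hσJ i) hp (hσp i) (hσy i j),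
        e := E i j, tame := htame' i j, intertwine := hE i j } := ⟨_, rfl⟩
  let R : ∀ i : η, Fin L → Set M'.V := fun i j => {v | ∀ l, letI := chartNodeGradedRing r (𝒜 i) (f i) (w i) (hf i) (d * k) (y i j) (hy i j);
    v ∉ M'.V.basicOpen ((E i j).symm ⟨z i j l, hz0 i j l⟩)}
  have hDW : ∀ i j, ∀ v ∈ (OW i j).1, v ∉ R i j → (DW i j).PrincipalNear v := by
    intro i j v _ hRv
    rw [hDWdef]
    simp only [R, Set.mem_setOf_eq, not_forall, not_not] at hRv
    obtain ⟨l, hvl⟩ := hRv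
    exact principalNear_producerChart_of_mem_residual hG (OW i j) (hOWaff i j) (E i j) (htame' i j) (hE i j) (h1 i) ⟨_, hz0 i j l⟩ (hzres i j l) hvl
  -- the charts cover `π′⁻¹ (⋃ Wᵢ)`
  have hcov : ∀ v' : M'.V, π'.base v' ∈ (⋃ i, ((W i).1 : Set M.V)) → ∃ ij : Σ _ : η, Fin L, v' ∈ (OW ij.1 ij.2).1 := fun v' hv => by
    obtain ⟨i, hvi⟩ := Set.mem_iUnion.mp hv
    have hcovW := iSup_blowupChart_eq_preimage (I := 𝒦.ideal d) M.act r (𝒜 i) (f i) (w i) (hf i) (W i) (hW i) (e i) hπ' (hverbar i) (hJ' i) (y i) (hy i) (hrad i)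
    have hv'W : v' ∈ ⨆ j, blowupChart π' ((𝒦.ideal d) ^ k) ⟨(W i).1, hW i⟩ ((e i).symm (y i j)) := by rw [hcovW]; exact hvi
    obtain ⟨j, hj⟩ := Opens.mem_iSup.mp hv'W
    exact ⟨⟨i, j⟩, by rw [hOWeq i j]; exact hj⟩
  obtain ⟨𝔄', hF⟩ := exists_moveAtlas_of_nodeData M M' 𝔄 𝒦 d (fun g => h𝒦G g d) π' hbl hr hcomm (⋃ i, ((W i).1 : Set M.V)) hsuppW
    (fun ij : Σ _ : η, Fin L => OW ij.1 ij.2) (fun ij => DW ij.1 ij.2) hcov (fun ij => R ij.1 ij.2) (fun ij => hDW ij.1 ij.2)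
  refine ⟨OW, hOWaff, hOWeq, E, htame', hE, hpin, 𝔄', fun v hv => ?_⟩
  rcases hF hv with hold | hnew
  · exact Or.inl hold
  · obtain ⟨⟨i, j⟩, hvO, hvR⟩ := Set.mem_iUnion.mp hnew
    exact Or.inr (Set.mem_iUnion.mpr ⟨i, Set.mem_iUnion.mpr ⟨j, hvO, hvR⟩⟩)

end Summit.ResolutionOfSingularities.ResolutionOfSingularities.Theorems.WildQuotientResolution.S1.GameFrame.GModel

end
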